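import Summits.ResolutionOfSingularities.ResolutionOfSingularities.Theorems.WeightedInvariantWeightedThesisHypersurfaceChoiceTChart
import Summits.ResolutionOfSingularities.ResolutionOfSingularities.Theorems.WeightedInvariantWeightedThesisTowerGenericQuotient
import HarnessLib

/-!
# The graded atlases of the cobordant tower consist of tower charts (RESHAPE 10, consumer side II)

Route `ResolutionOfSingularities/WeightedInvariant`, crux `Theses.WeightedInvariant.WeightedThesis`
(stmt-ResolutionOfSingularities-0569), line `datum-glued-split`, lead c9, RESHAPE 10.

The datum-free step lemmas of the tower (`Theorems/WeightedInvariantWeightedThesisTowerGenericQuotient.lean`,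
lead c7: `Atlas.gradedAtlas_succ_of_isRegularWeightedCentre`, `DatumToEmbedded.quotientStep_of_isRegularWeightedCentre`)
re-run with the ambient charts taken from `AtlasAmbient.exists_ambientChart_towerTyped`
(`Theorems/…HypersurfaceChoiceTChart.lean`), so that the graded atlas of rank `j + 1` produced on the
cobordant blow-up comes WITH the fact that each of its charts is a `TowerChartStep` over a chart of the
rank-`j` atlas — the induction invariant that makes every chart the route's tower ever reads a tower
chart (`HypersurfacePair.IsTowerChart`), hence covered by the constructor's `(H_T)`:

* `Atlas.gradedAtlas_succ_towerTyped` — verbatim `gradedAtlas_succ_of_isRegularWeightedCentre`, conclusion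
  strengthened from `Nonempty (GradedAtlas (j+1) …)` to `∃ 𝒜', ∀ b, ∃ a, TowerChartStep (W a) j (piece a) R' (W' b) (piece' b)`;
* `DatumToEmbedded.quotientStep_towerTyped` — verbatim `quotientStep_of_isRegularWeightedCentre` with the
  same strengthening threaded through; `hyp_quotientStep_towerTyped` (registered stub of the line) — its
  registered form.

All proofs are glue on the tree (adapted from the files named); no definitions, no named facts.
-/

noncomputable section

open scoped LaurentPolynomial
open CategoryTheory CategoryTheory.Limits AlgebraicGeometry TopologicalSpace
open Literature.AlgebraicGeometry.Resolution
open Summit.ResolutionOfSingularities.ResolutionOfSingularities.Theses.WeightedInvariant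
open Summit.ResolutionOfSingularities.ResolutionOfSingularities.Theorems

set_option linter.dupNamespace false -- mandated namespace `…Theorems.DatumToEmbedded.<Topic>`
-- `Γ(B₊, W')` versus `presheaf.obj` inside `rw` motives and instance problems on the glued scheme
-- `R'.cobordantBlowup` / `R'.plus` (as in `…TowerGenericQuotient`):
set_option backward.isDefEq.respectTransparency false

/-! ## The graded atlas of rank `j + 1`, tower-typed -/

namespace Summit.ResolutionOfSingularities.ResolutionOfSingularities.Theorems.DatumToEmbedded.Atlas

-- adapted from Theorems/WeightedInvariantWeightedThesisTowerGenericQuotient.lean (gradedAtlas_succ_of_isRegularWeightedCentre)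
/-- **The graded atlas of rank `j + 1` on the blow-up of the quotient consists of TOWER CHARTS**
(RESHAPE 10): the datum-free `gradedAtlas_succ_of_isRegularWeightedCentre` (Włodarczyk §2.3.3 "the
quotient of the cobordant blow-up is the blow-up downstairs", in the graded encoding) with every ambient
chart of the new atlas certified as a `TowerChartStep` over a chart of the old one — its grading is (old
`ℤʲ`-degree, `t`-degree) on `(⊕ₙ 𝒥ₙ(W a) tⁿ)[1/β t^{Dg}]`. [cite: Wlodarczyk2022, §2.3.3] -/
theorem gradedAtlas_succ_towerTyped :
    ∀ {k : Type} [Field k]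
      {Y X V : Scheme.{0}} (f : Y ⟶ Spec (.of k)) [Smooth f] [IsSeparated f] [QuasiCompact f]
      (i : X ⟶ Y) [IsClosedImmersion i] [IsIntegral X] (q : X ⟶ V) [IsIntegral V]
      (g : V ⟶ Spec (.of k)) [IsSeparated g] [LocallyOfFiniteType g] [QuasiCompact g],
      q ≫ g = i ≫ f →
      ∀ {j : ℕ} (𝒜 : GradedAtlas j f i q) (R : ReesAlgebraData Y), R.IsRegularWeightedCentre →
      i (genericPoint X) ∉ R.support →
      (∀ (a : 𝒜.ι) (n : ℕ), @Ideal.IsHomogeneous (Fin j → ℤ) (AddSubgroup Γ(Y, 𝒜.W a))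
        Γ(Y, 𝒜.W a) _ _ _ (𝒜.piece a) _ _ (𝒜.gradedRing a)
        ((R.piece n).ideal (𝒜.W a))) →
      ∀ (R' : ReesFiltration Y), R'.ideal = R.piece →
      ∀ [Smooth (R'.πPlus ≫ f)] [IsSeparated (R'.πPlus ≫ f)] [QuasiCompact (R'.πPlus ≫ f)]
        [IsIntegral (R'.strictTransformPlus i.ker).subscheme]
        (σX : (R'.strictTransformPlus i.ker).subscheme ⟶ X),
        σX ≫ i = (R'.strictTransformPlus i.ker).subschemeι ≫ R'.πPlus →
      ∀ (Dg : ℕ), 0 < Dg →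
      (R.piece Dg).comap R'.πPlus = R'.excPlus ^ Dg →
      (∀ (a : 𝒜.ι) (l : ℕ) (x : Γ(Y, 𝒜.W a)),
          x ∈ (R.piece (Dg * (l + 1))).ideal (𝒜.W a) → x ∈ 𝒜.piece a 0 →
          ∃ y ∈ AddSubgroup.closure
            {z : Γ(Y, 𝒜.W a) | ∃ u v : Γ(Y, 𝒜.W a),
              u ∈ (R.piece Dg).ideal (𝒜.W a) ∧ u ∈ 𝒜.piece a 0 ∧
              v ∈ (R.piece (Dg * l)).ideal (𝒜.W a) ∧ v ∈ 𝒜.piece a 0 ∧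
              z = u * v},
            x - y ∈ i.ker.ideal (𝒜.W a)) →
      ((((R.piece Dg).comap i).subschemeι ≫ q).ker).comap (σX ≫ q) =
          (R'.excPlus.comap (R'.strictTransformPlus i.ker).subschemeι) ^ Dg →
      ∀ (V' : Scheme.{0}) (ρ : V' ⟶ V),
        IsBlowup ρ (((R.piece Dg).comap i).subschemeι ≫ q).ker →
        ∀ [IsIntegral V'] (q' : (R'.strictTransformPlus i.ker).subscheme ⟶ V'),
          q' ≫ ρ = σX ≫ q →
          ∃ 𝒜' : GradedAtlas (j + 1) (R'.πPlus ≫ f) (R'.strictTransformPlus i.ker).subschemeι q',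
            ∀ b : 𝒜'.ι, ∃ a : 𝒜.ι, TowerChartStep (𝒜.W a) j (𝒜.piece a) R' (𝒜'.W b) (𝒜'.piece b) := by
  intro k _ Y X V f _ _ _ i _ _ q _ g _ _ _ hq j 𝒜 R hc hξ hhom R' hR' _ _ _ _ σX hσX
    Dg hDg hexc hA2 hA3 V' ρ hρ _ q' hq'
  -- `Y` and `B` are locally Noetherian (the centre is a regular weighted centre)
  haveI : IsLocallyNoetherian Y := LocallyOfFiniteType.isLocallyNoetherian f
  haveI : LocallyOfFiniteType R'.π :=
    WeightedThesis.GlobalCobordantPlus.locallyOfFiniteType_π R R' hR' hc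
  haveI : IsLocallyNoetherian R'.cobordantBlowup := LocallyOfFiniteType.isLocallyNoetherian R'.π
  -- `q` is quasi-compact (it is so after composition with the separated `g`)
  haveI : QuasiCompact q := by
    haveI : QuasiCompact (q ≫ g) := by rw [hq]; infer_instance
    exact .of_comp q g
  -- `V` is locally Noetherian (of finite type over the field `k`)
  haveI : IsLocallyNoetherian V := LocallyOfFiniteType.isLocallyNoetherian g
  -- `t⁻¹` is not identically zero on the integral strict transform `X'`
  have hτ := Lift.nonempty_preimage_basicOpen_of_not_mem_support i R hc R' hR' hξ
  -- (0) finitely many generators of the downstairs centre `K(U a)` on every chart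
  choose s hs using fun a : 𝒜.ι =>
    exists_finset_span_eq ((((R.piece Dg).comap i).subschemeι ≫ q).ker) (𝒜.U a)
  have hbK : ∀ ab : (Σ a : 𝒜.ι, ↥(s a)), (ab.2 : Γ(V, 𝒜.U ab.1)) ∈
      ((((R.piece Dg).comap i).subschemeι ≫ q).ker).ideal (𝒜.U ab.1) :=
    fun ab => (hs ab.1).le (Ideal.subset_span (Finset.mem_coe.mpr ab.2.2))
  -- (1) degree-zero lifts `β` of the generators, the ambient charts, the quotient charts
  have hβex : ∀ ab : (Σ a : 𝒜.ι, ↥(s a)), ∃ β : Γ(Y, 𝒜.W ab.1),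
      β ∈ (R.piece Dg).ideal (𝒜.W ab.1) ∧ β ∈ 𝒜.piece ab.1 0 ∧
        i.app (𝒜.W ab.1) β = q.appLE (𝒜.U ab.1) (i ⁻¹ᵁ (𝒜.W ab.1)) (𝒜.preimage_eq ab.1).le
          (ab.2 : Γ(V, 𝒜.U ab.1)) :=
    fun ab => exists_degreeZero_lift 𝒜 R.piece Dg ab.1 (hhom ab.1 Dg) (hbK ab)
  choose β hβJ hβ0 hβ using hβex
  choose 𝒞 h𝒞 hT using fun ab : (Σ a : 𝒜.ι, ↥(s a)) =>
    AtlasAmbient.exists_ambientChart_towerTyped f i q 𝒜 R' hR' ab.1 (hhom ab.1) hDg (hβJ ab) (hβ0 ab)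
  -- the quotient charts under the ambient charts (Q1)–(Q4)
  have hQ1 := fun ab : (Σ a : 𝒜.ι, ↥(s a)) =>
    AtlasQuotient.preimage_W'_eq f i q 𝒜 R.piece R' σX hσX Dg _ ρ q' hq' ab.1 hτ hA3 hρ hexc
      (hbK ab) (hβJ ab) (hβ ab) (𝒞 ab)
  have hQ := fun ab : (Σ a : 𝒜.ι, ↥(s a)) =>
    And.intro (hQ1 ab) (And.intro (AtlasQuotient.appLE_blowupChart_mem_nonZeroDivisors hρ (hbK ab))
      (And.intro (fun c' => AtlasQuotient.exists_of_section_blowupChart hρ (hbK ab) c')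
        (And.intro (fun (l : ℕ) (c : Γ(V, 𝒜.U ab.1))
            (hc' : c ∈ ((((R.piece Dg).comap i).subschemeι ≫ q).ker.ideal (𝒜.U ab.1)) ^ l) =>
            AtlasQuotient.exists_section_blowupChart hρ (hbK ab) hc')
          (AtlasQuotient.app_blowupChart_injective f i q 𝒜 _ R' σX hσX Dg _ ρ hρ q' hq' ab.1
            (hbK ab) (hβ ab) (𝒞 ab) (h𝒞 ab) (hQ1 ab)))))
  -- (2)-(5) the atlas
  refine ⟨{
    ι := Σ a : 𝒜.ι, ↥(s a)
    finite_ι := by haveI := 𝒜.finite_ι; infer_instance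
    U := fun ab => ⟨blowupChart ρ ((((R.piece Dg).comap i).subschemeι ≫ q).ker)
      (𝒜.U ab.1) (ab.2 : Γ(V, 𝒜.U ab.1)), hρ.isAffineOpen_blowupChart (hbK ab)⟩
    iSup_eq_top := stub_qs_atlasCover hρ 𝒜.U 𝒜.iSup_eq_top s hs
    W := fun ab => (𝒞 ab).W'
    preimage_eq := fun ab => (hQ ab).1
    piece := fun ab => (𝒞 ab).piece
    gradedRing := fun ab => (𝒞 ab).gradedRing
    appLE_mem := fun ab c => (𝒞 ab).const_mem c
    isHomogeneous_ker := fun ab => isHomogeneous_ker_chart (𝒞 ab)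
    exists_preimage := fun ab s' hs' =>
      exists_preimage_chart 𝒜 R.piece Dg hσX hτ hq' ab.1 (hβ ab) (𝒞 ab)
        (blowupChart_le_preimage ρ _ (𝒜.U ab.1) _) (hQ ab).1 (hA2 ab.1) (hQ ab).2.2.2.1 s' hs'
    exists_lift := fun ab c' =>
      exists_lift_chart 𝒜 R.piece Dg hσX hτ hq' ab.1 (hβ ab) (𝒞 ab)
        (blowupChart_le_preimage ρ _ (𝒜.U ab.1) _) (hQ ab).1 R.piece_zero
        R.piece_mul_le (hhom ab.1 Dg) (hQ ab).2.2.1 c'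
    appLE_injective := fun ab => appLE_injective_of_eq _ (hQ ab).1 (hQ ab).2.2.2.2
    exponent := 𝒜.exponent * Dg
    exponent_pos := Nat.mul_pos 𝒜.exponent_pos hDg
    exists_unit := ?_ }, fun ab => ⟨ab.1, hT ab⟩⟩
  · -- homogeneous units of all degrees in `(e Dg)·ℤʲ⁺¹` near every point of `X'`
    intro x'
    obtain ⟨a, hxa, hunits⟩ := 𝒜.exists_unit (σX x')
    have hqx : ρ (q' x') ∈ (𝒜.U a : V.Opens) := by
      have e1 : (q' ≫ ρ) x' = ρ (q' x') := Scheme.Hom.comp_apply _ _ _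
      rw [← e1, hq', Scheme.Hom.comp_apply]
      change σX x' ∈ q ⁻¹ᵁ (𝒜.U a : V.Opens)
      rw [← 𝒜.preimage_eq a]
      exact hxa
    obtain ⟨b, hb⟩ := exists_mem_blowupChart hρ (𝒜.U a) (s a) (hs a) hqx
    refine ⟨⟨a, b⟩, ?_, fun χ' => exists_unit_chart hσX (𝒞 ⟨a, b⟩) 𝒜.exponent hunits χ'⟩
    have h : x' ∈ q' ⁻¹ᵁ blowupChart ρ _ (𝒜.U a) (b : Γ(V, 𝒜.U a)) := hb
    rw [← (hQ ⟨a, b⟩).1] at h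
    exact h

end Summit.ResolutionOfSingularities.ResolutionOfSingularities.Theorems.DatumToEmbedded.Atlas

/-! ## The quotient step, tower-typed -/

namespace Summit.ResolutionOfSingularities.ResolutionOfSingularities.Theorems.DatumToEmbedded

-- adapted from Theorems/WeightedInvariantWeightedThesisTowerGenericQuotient.lean (quotientStep_of_isRegularWeightedCentre)
/-- **The quotient of the cobordant blow-up is a blow-up downstairs, tower-typed** (RESHAPE 10): the
datum-free `quotientStep_of_isRegularWeightedCentre` — an ideal sheaf `K ≠ ⊥` on `V` such that for every
blow-up `ρ : V' ⟶ V` along `K` the strict transform maps to `V'` over `X ⟶ V` with a graded atlas of rank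
`j + 1` — whose atlas moreover consists of tower charts over the charts of `𝒜`.
[cite: Wlodarczyk2022, §2.3.3 and Thm 1.1.4 (5)] -/
theorem quotientStep_towerTyped
    {k : Type} [Field k]
    {Y X V : Scheme.{0}} (f : Y ⟶ Spec (.of k)) [Smooth f] [IsSeparated f] [QuasiCompact f]
    (i : X ⟶ Y) [IsClosedImmersion i] [IsIntegral X] (q : X ⟶ V) [IsIntegral V]
    (g : V ⟶ Spec (.of k)) [IsSeparated g] [LocallyOfFiniteType g] [QuasiCompact g]
    (hq : q ≫ g = i ≫ f) {j : ℕ} (𝒜 : GradedAtlas j f i q)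
    (R : ReesAlgebraData Y) (hc : R.IsRegularWeightedCentre) (hξ : i (genericPoint X) ∉ R.support)
    (hhom : ∀ (a : 𝒜.ι) (n : ℕ), @Ideal.IsHomogeneous (Fin j → ℤ) (AddSubgroup Γ(Y, 𝒜.W a))
      Γ(Y, 𝒜.W a) _ _ _ (𝒜.piece a) _ _ (𝒜.gradedRing a)
      ((R.piece n).ideal (𝒜.W a)))
    (R' : ReesFiltration Y) (hR' : R'.ideal = R.piece)
    [Smooth (R'.πPlus ≫ f)] [IsSeparated (R'.πPlus ≫ f)] [QuasiCompact (R'.πPlus ≫ f)]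
    [IsIntegral (R'.strictTransformPlus i.ker).subscheme]
    (σX : (R'.strictTransformPlus i.ker).subscheme ⟶ X)
    (hσX : σX ≫ i = (R'.strictTransformPlus i.ker).subschemeι ≫ R'.πPlus) :
    ∃ K : V.IdealSheafData, K ≠ ⊥ ∧ ∀ (V' : Scheme.{0}) (ρ : V' ⟶ V), IsBlowup ρ K →
      ∀ [IsIntegral V'], ∃ q' : (R'.strictTransformPlus i.ker).subscheme ⟶ V',
        q' ≫ ρ = σX ≫ q ∧
        ∃ 𝒜' : GradedAtlas (j + 1) (R'.πPlus ≫ f) (R'.strictTransformPlus i.ker).subschemeι q',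
          ∀ b : 𝒜'.ι, ∃ a : 𝒜.ι, TowerChartStep (𝒜.W a) j (𝒜.piece a) R' (𝒜'.W b) (𝒜'.piece b) := by
  haveI : CompactSpace Y := QuasiCompact.compactSpace_of_compactSpace f
  haveI : IsLocallyNoetherian Y := LocallyOfFiniteType.isLocallyNoetherian f
  obtain ⟨N₀, hN₀, hexc⟩ :=
    Exceptional.exists_veroneseExceptional_of_isRegularWeightedCentre R hc R' hR'
  obtain ⟨Dg, hDg, hdvd, hA2, hA3⟩ :=
    Degree.qs_degree_of_isRegularWeightedCentre f i q g hq 𝒜 R hc hhom R' hR' σX hσX N₀ hN₀ hexc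
  -- `q` is quasi-compact: it is affine on the charts of the atlas (needed for `Hom.ker`)
  haveI : QuasiCompact q := by
    haveI : QuasiCompact (q ≫ g) := by rw [hq]; infer_instance
    exact .of_comp q g
  obtain ⟨hK, hlift⟩ := Lift.qs_lift_of_not_mem_support i q R hc R' hR' hξ σX hσX Dg hDg hA3
  refine ⟨_, hK, fun V' ρ hρ _ => ?_⟩
  obtain ⟨q', hq'⟩ := hlift V' ρ hρ
  exact ⟨q', hq', Atlas.gradedAtlas_succ_towerTyped f i q g hq 𝒜 R hc hξ hhom R' hR'
    σX hσX Dg hDg (hexc Dg hdvd) hA2 hA3 V' ρ hρ q' hq'⟩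

/-- **Registered form `hyp_quotientStep_towerTyped`** of `quotientStep_towerTyped` (registered stub of line
`datum-glued-split`, RESHAPE 10, on crux stmt-0569): the quotient step of the cobordant tower for an arbitrary
regular weighted centre off the generic point of `X`, with the successor atlas certified to consist of tower
charts over the charts of `𝒜`. [cite: Wlodarczyk2022, §2.3.3 and Thm 1.1.4 (5)] -/
theorem hyp_quotientStep_towerTyped : ∀ {k : Type} [Field k] {Y X V : AlgebraicGeometry.Scheme.{0}} (f : Y ⟶ AlgebraicGeometry.Spec (.of k)) [AlgebraicGeometry.Smooth f] [AlgebraicGeometry.IsSeparated f] [AlgebraicGeometry.QuasiCompact f] (i : X ⟶ Y) [AlgebraicGeometry.IsClosedImmersion i] [AlgebraicGeometry.IsIntegral X] (q : X ⟶ V) [AlgebraicGeometry.IsIntegral V] (g : V ⟶ AlgebraicGeometry.Spec (.of k)) [AlgebraicGeometry.IsSeparated g] [AlgebraicGeometry.LocallyOfFiniteType g] [AlgebraicGeometry.QuasiCompact g], q ≫ g = i ≫ f → ∀ {j : ℕ} (𝒜 : Summit.ResolutionOfSingularities.ResolutionOfSingularities.Theorems.GradedAtlas j f i q) (R : Literature.AlgebraicGeometry.Resolution.ReesAlgebraData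 Y), R.IsRegularWeightedCentre → i (genericPoint X) ∉ R.support → (∀ (a : 𝒜.ι) (n : ℕ), @Ideal.IsHomogeneous (Fin j → ℤ) (AddSubgroup Γ(Y, 𝒜.W a)) Γ(Y, 𝒜.W a) _ _ _ (𝒜.piece a) _ _ (𝒜.gradedRing a) ((R.piece n).ideal (𝒜.W a))) → ∀ (R' : Literature.AlgebraicGeometry.Resolution.ReesFiltration Y), R'.ideal = R.piece → ∀ [AlgebraicGeometry.Smooth (R'.πPlus ≫ f)] [AlgebraicGeometry.IsSeparated (R'.πPlus ≫ f)] [AlgebraicGeometry.QuasiCompact (R'.πPlus ≫ f)] [AlgebraicGeometry.IsIntegral (R'.strictTransformPlus i.ker).subscheme] (σX : (R'.strictTransformPlus i.ker).subscheme ⟶ X), σX ≫ i = (R'.strictTransformPlus i.ker).subschemeι ≫ R'.πPlus → ∃ K : V.IdealSheafData, K ≠ ⊥ ∧ ∀ (V' : AlgebraicGeometry.Scheme.{0}) (ρ : V' ⟶ V), Literature.AlgebraicGeometry.Resolution.IsBlowup ρ K → ∀ [AlgebraicGeometry.IsIntegral V'], ∃ q' : (R'.strictTransformPlus i.ker).subscheme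 ⟶ V', q' ≫ ρ = σX ≫ q ∧ ∃ 𝒜' : Summit.ResolutionOfSingularities.ResolutionOfSingularities.Theorems.GradedAtlas (j + 1) (R'.πPlus ≫ f) (R'.strictTransformPlus i.ker).subschemeι q', ∀ b : 𝒜'.ι, ∃ a : 𝒜.ι, Summit.ResolutionOfSingularities.ResolutionOfSingularities.Theorems.TowerChartStep (𝒜.W a) j (𝒜.piece a) R' (𝒜'.W b) (𝒜'.piece b) := by
  intro k _ Y X V f _ _ _ i _ _ q _ g _ _ _ hq j 𝒜 R hc hξ hhom R' hR' _ _ _ _ σX hσX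
  exact quotientStep_towerTyped f i q g hq 𝒜 R hc hξ hhom R' hR' σX hσX

end Summit.ResolutionOfSingularities.ResolutionOfSingularities.Theorems.DatumToEmbedded

end
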